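import Mathlib.RepresentationTheory.Basic
import HarnessLib

/-!
# The involution fixed-span lemma: `M = ∑_{s ∈ C} M^s` when `M` has no `ε`-isotypic vector

Topic `Literature/RepresentationTheory/FiniteGroups`. A THEOREM (proved here; no named fact).

Let `G` be a finite group acting `k`-linearly on `M` (`ρ : Representation k G M`, `k` a field with
`(|G| : k) ≠ 0`), `C ⊆ G` a set of involutions, closed under conjugation and generating `G`, and
`ε : G →* kˣ` a linear character with `ε(s) = −1` on `C`. **If `M` has no non-zero `ε`-isotypic
vector then `M` is the sum of the fixed subspaces `M^s = ker(ρ s − 1)`, `s ∈ C`**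
(`fixedSpan_eq_top`). Equivalently: `G` acts on `M / ∑_s M^s` through `ε` (every generator `s`
acts as `−1 = ε(s)` there), and by averaging [cite: Serre1977, §2.6 Thm 8(ii) (p. 21): the
projection onto the `χᵢ`-isotypic component is `pᵢ = (nᵢ/g) ∑_{t∈G} χᵢ(t)* ρ_t`] an `ε`-isotypic
quotient vector lifts to an `ε`-isotypic vector of `M`; the proof below is the elementary
averaging argument written without quotients (no Maschke needed beyond `|G|` invertible).

Typical use (reflection groups): `C` = reflections, `ε = det`; e.g. for `G = A ⋊ 𝔖₆ ⊂ GL₆` generated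
by the 90 complex reflections `xᵢ ↔ ζ xⱼ` acting on the Katz-flat part of `H⁴` of a Dwork-pencil
sextic fourfold, where `det|_A = 1` while `A` acts on each flat eigen-piece through a non-trivial
character, so no flat `det`-isotypic vector exists and every flat class is a sum of
reflection-invariant classes (cell hodge-nonav, route `DworkReflectionQuotients`, item
`FlatClassesSpannedByReflectionInvariants` = stmt-HodgeConjecture-20241; this file is its proved
representation-theoretic input, transcribed from the cell's `RepLemma.lean`, sha256/16 8b3a33338b67a34c).

## Contents

* `mem_fixedSpan_of_fixed`, `map_fixedSpan_le` (`G`-stability of `⨆ s ∈ C, ker (ρ s − id)` for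
  conjugation-closed `C`);
* `fixedSpan_eq_top` — the lemma, stated for the submodule `⨆ s ∈ C, LinearMap.ker (ρ s - LinearMap.id)`
  written out (no auxiliary definition, so that users can rewrite with it directly).

## References

* J.-P. Serre, *Linear Representations of Finite Groups*, GTM 42, Springer 1977, §2.6 Theorem 8(ii)
  (projector onto an isotypic component), p. 21. [Serre1977]
-/

namespace Literature.RepresentationTheory.FiniteGroups

open BigOperators

variable {k G M : Type*} [Field k] [Group G] [AddCommGroup M] [Module k M]

/-- A vector fixed by some `s ∈ C` lies in the fixed span `⨆ s ∈ C, ker (ρ s − id)` [folklore]. -/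
private theorem mem_fixedSpan_of_fixed (ρ : Representation k G M) (C : Set G) {s : G} (hs : s ∈ C)
    {x : M} (hx : ρ s x = x) : x ∈ (⨆ s ∈ C, LinearMap.ker (ρ s - LinearMap.id)) := by
  have hx' : x ∈ LinearMap.ker (ρ s - LinearMap.id) := by
    simp [LinearMap.mem_ker, hx]
  exact Submodule.mem_iSup_of_mem s (Submodule.mem_iSup_of_mem hs hx')

/-- The fixed span `⨆ s ∈ C, ker (ρ s − id)` is `G`-stable when `C` is closed under conjugation
(`g M^s = M^{gsg⁻¹}`) [folklore]. -/
private theorem map_fixedSpan_le (ρ : Representation k G M) (C : Set G)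
    (hC : ∀ s ∈ C, ∀ g : G, g * s * g⁻¹ ∈ C) (g : G) :
    (⨆ s ∈ C, LinearMap.ker (ρ s - LinearMap.id)).map (ρ g) ≤ (⨆ s ∈ C, LinearMap.ker (ρ s - LinearMap.id)) := by
  rw [Submodule.map_iSup]
  refine iSup_le fun s => ?_
  rw [Submodule.map_iSup]
  refine iSup_le fun hs => ?_
  rintro y ⟨x, hx, rfl⟩
  have hx' : ρ s x = x := by
    simpa [LinearMap.mem_ker, sub_eq_zero] using hx
  apply mem_fixedSpan_of_fixed ρ C (hC s hs g)
  rw [map_mul, map_mul, Module.End.mul_apply, Module.End.mul_apply, ← Module.End.mul_apply (ρ g⁻¹) (ρ g),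
    ← map_mul, inv_mul_cancel, map_one, Module.End.one_apply, hx']

/-- **Det-free span lemma** (involution fixed-span lemma). Let a finite group `G` act `k`-linearly
on `M` with `|G| ≠ 0` in the field `k`, let `C ⊆ G` be a conjugation-closed set of involutions
generating `G`, and let `ε : G →* kˣ` be a linear character with `ε(s) = −1` for all `s ∈ C`. If `M`
has no non-zero `ε`-isotypic vector (`ρ g m = ε(g) m ∀ g ⇒ m = 0`), then `M = ∑_{s ∈ C} M^s`.
Proof: `m + ρ s m ∈ M^s` for `s ∈ C`, hence (words in `C`, `G`-stability) `m − ε(g)⁻¹ ρ g m ∈ ∑ M^s`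
for every `g`; summing over `G`, `|G|·m − ∑_g ε(g)⁻¹ ρ g m ∈ ∑ M^s`, and the averaged vector is
`ε`-isotypic — it is `|G|` times Serre's projector `p_ε = (1/g) ∑_t ε(t)* ρ_t` onto the `ε`-isotypic
component [cite: Serre1977, §2.6 Thm 8(ii) (p. 21)] — hence zero. Cell hodge-nonav, route
`DworkReflectionQuotients`, support input of item `FlatClassesSpannedByReflectionInvariants`
(stmt-HodgeConjecture-20241): `G = A ⋊ 𝔖₆` on the Katz-flat part of `H⁴(X_ψ)`, `C` = the 90
reflections `xᵢ ↔ ζxⱼ`, `ε = det`. Statement and proof transcribed from the cell file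
HOME/p2/route/RepLemma.lean (planner-hodge-nonav-p2, sha256/16 8b3a33338b67a34c). -/
theorem fixedSpan_eq_top [Fintype G] (ρ : Representation k G M) (C : Set G)
    (hC : ∀ s ∈ C, ∀ g : G, g * s * g⁻¹ ∈ C) (hinv : ∀ s ∈ C, s * s = 1)
    (hgen : Subgroup.closure C = ⊤) (ε : G →* kˣ) (hε : ∀ s ∈ C, (ε s : k) = -1)
    (hcard : (Fintype.card G : k) ≠ 0)
    (hiso : ∀ m : M, (∀ g : G, ρ g m = (ε g : k) • m) → m = 0) :
    (⨆ s ∈ C, LinearMap.ker (ρ s - LinearMap.id)) = ⊤ := by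
  set N := (⨆ s ∈ C, LinearMap.ker (ρ s - LinearMap.id)) with hN
  have hstab : ∀ g : G, ∀ x ∈ N, ρ g x ∈ N := fun g x hx =>
    map_fixedSpan_le ρ C hC g ⟨x, hx, rfl⟩
  -- Step 1: for every `g` and `m`, `m − ε(g)⁻¹ • ρ g m ∈ N` (induction over words in `C`).
  have key : ∀ g : G, ∀ m : M, m - (((ε g)⁻¹ : kˣ) : k) • ρ g m ∈ N := by
    intro g
    have hg : g ∈ Subgroup.closure C := by rw [hgen]; exact Subgroup.mem_top g
    induction hg using Subgroup.closure_induction with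
    | mem s hs =>
      intro m
      have h1 : (((ε s)⁻¹ : kˣ) : k) = -1 := by
        rw [Units.val_inv_eq_inv_val, hε s hs, inv_neg, inv_one]
      rw [h1, neg_one_smul, sub_neg_eq_add]
      apply mem_fixedSpan_of_fixed ρ C hs
      rw [map_add, ← Module.End.mul_apply, ← map_mul, hinv s hs, map_one, Module.End.one_apply, add_comm]
    | one =>
      intro m
      simp only [map_one, inv_one, Units.val_one, one_smul, Module.End.one_apply, sub_self]
      exact N.zero_mem
    | mul g₁ g₂ _ _ h₁ h₂ =>
      intro m
      have e : m - (((ε (g₁ * g₂))⁻¹ : kˣ) : k) • ρ (g₁ * g₂) m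
          = (m - (((ε g₁)⁻¹ : kˣ) : k) • ρ g₁ m)
            + (((ε g₁)⁻¹ : kˣ) : k) • ρ g₁ (m - (((ε g₂)⁻¹ : kˣ) : k) • ρ g₂ m) := by
        rw [map_mul, map_mul, mul_inv, Units.val_mul, Module.End.mul_apply, map_sub, map_smul, smul_sub,
          ← mul_smul]
        abel
      rw [e]
      exact N.add_mem (h₁ m) (N.smul_mem _ (hstab _ _ (h₂ m)))
    | inv g _ hg =>
      intro m
      have h := hg (ρ g⁻¹ m)
      rw [← Module.End.mul_apply, ← map_mul, mul_inv_cancel, map_one, Module.End.one_apply] at h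
      have h2 := N.smul_mem (-((ε g : kˣ) : k)) h
      have e : -((ε g : kˣ) : k) • (ρ g⁻¹ m - (((ε g)⁻¹ : kˣ) : k) • m)
          = m - (((ε g⁻¹)⁻¹ : kˣ) : k) • ρ g⁻¹ m := by
        rw [map_inv ε, inv_inv, smul_sub, ← mul_smul, neg_mul, Units.mul_inv, neg_smul, neg_one_smul]
        abel
      rw [e] at h2
      exact h2
  -- Step 2: the ε-averaging of any `m` is ε-isotypic, hence zero.
  have hP : ∀ m : M, ∑ g : G, (((ε g)⁻¹ : kˣ) : k) • ρ g m = 0 := by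
    intro m
    apply hiso
    intro h
    simp only [map_sum, map_smul]
    rw [Finset.smul_sum]
    have hterm : ∀ g : G, (((ε g)⁻¹ : kˣ) : k) • ρ h (ρ g m)
        = (ε h : k) • ((((ε (h * g))⁻¹ : kˣ) : k) • ρ (h * g) m) := by
      intro g
      rw [← Module.End.mul_apply, ← map_mul, map_mul ε, mul_inv, Units.val_mul, ← mul_smul, ← mul_assoc,
        Units.mul_inv, one_mul]
    calc ∑ g : G, (((ε g)⁻¹ : kˣ) : k) • ρ h (ρ g m)
        = ∑ g : G, (fun g' => (ε h : k) • ((((ε g')⁻¹ : kˣ) : k) • ρ g' m)) (Equiv.mulLeft h g) := by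
          refine Finset.sum_congr rfl fun g _ => ?_
          rw [hterm g]; rfl
      _ = ∑ g' : G, (ε h : k) • ((((ε g')⁻¹ : kˣ) : k) • ρ g' m) :=
          Equiv.sum_comp (Equiv.mulLeft h) (fun g' => (ε h : k) • ((((ε g')⁻¹ : kˣ) : k) • ρ g' m))
  -- Step 3: `|G| • m − (averaging of m) ∈ N`, so `m ∈ N`.
  rw [eq_top_iff]
  rintro m -
  have hsum : ∑ g : G, (m - (((ε g)⁻¹ : kˣ) : k) • ρ g m) ∈ N := N.sum_mem fun g _ => key g m
  rw [Finset.sum_sub_distrib, hP m, sub_zero, Finset.sum_const, Finset.card_univ] at hsum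
  have h3 : ((Fintype.card G : k)⁻¹ * (Fintype.card G : k)) • m ∈ N := by
    rw [mul_smul, Nat.cast_smul_eq_nsmul]
    exact N.smul_mem _ hsum
  rwa [inv_mul_cancel₀ hcard, one_smul] at h3

end Literature.RepresentationTheory.FiniteGroups
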